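import Summits.BirchSwinnertonDyer.BirchSwinnertonDyer.Theorems.SignedLowerHalvesSmallImageLowerHalfBothSignsRttCharRoadFrame2
import Summits.BirchSwinnertonDyer.BirchSwinnertonDyer.Theorems.SignedLowerHalvesSmallImageLowerHalfBothSignsRttD2FrameConductor
import Mathlib.RingTheory.Finiteness.Ideal
import HarnessLib

/-!
# Route `SignedLowerHalves`, crux L `SmallImageLowerHalfBothSigns` (stmt-BirchSwinnertonDyer-23599), line `rtt_w3` v17 — ★★★ THE REGISTERED INPUT STUB `stub_frameLayers_ns`
# (hLay: THE LAYERS OF EVERY `ℤ_p`-EXTENSION OF `K` LIE IN THE RAY CLASS FIELDS `K(𝔪·p^{c+1})`, `c ≫ 0`) PROVED BY NAME — class field theory of `ℤ_p`-extensions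

INPUTS hand `bsd-inputs-honda-p1` g25 under LEAD `cruxlead-stmt-BirchSwinnertonDyer-23599` g11/g12 (v17 registry act: `Lines/rtt_w3.lean` sha16 fcf7274c1cf56fa1; the stub is consumed
by `SmallImageRttCharRoadFrame₂.stub_charRoadFrame_ns_of₂`, p796938). MATHEMATICS ([Washington1997] Prop. 13.2, §13.1; [NeukirchANT1999] VI §6 (6.4)–(6.6)): for a
`ℤ_p`-extension `κ'` of the totally complex field `K` and `n ≥ 0`, the layer `K'_n/K` is abelian and unramified outside `p` (inertia at `w ∤ p` lies in `ker κ'`, tree theorem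
`ZpExtension.inertia_le_kerSubgroup_holds`), so its conductor `𝔣ₙ` is supported on the primes above `p` (honda g24's `exists_ideal_forall_pow_dvd_supp`, from
`conductor_le_iff_not_isUnramifiedIn` + `isUnramifiedIn_layer_of_not_mem`) and `K'_n ⊆ K(𝔣ₙ)` (`le_rayClassField_conductor`); a non-zero ideal supported above `p` contains
`(p)^N` for some `N` (`(p) ≤ √𝔣ₙ`, `Ideal.exists_pow_le_of_le_radical_of_fg`), hence `K'_n ⊆ K(𝔣ₙ) ⊆ K(𝔪·p^{c'+1})` for all `c' + 1 ≥ N` (ray class fields grow with the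
modulus, `rayClassField_le_of_le`); on `Gal(K̄/K'_n)` one has `pⁿ ∣ κ'`, i.e. `‖κ'‖ ≤ ‖p‖ⁿ < δ`.
* §1 `span_natCast_le_radical_of_supp`, `exists_span_pow_le_of_supp` — an ideal `𝔣 ≠ 0` with `𝔣 ≤ 𝔭_w ⇒ w ∣ p` contains a power of `(p)`;
* §2 ★ `exists_forall_norm_toAdd_lt_of_mem_absGaloisFixingSubgroup` — the hLay binder for one `κ'` (any totally complex `K`, any `𝔪 ≠ 0`);
* §3 ★★★ `stub_frameLayers_ns` — THE REGISTERED SIGNATURE VERBATIM (crux prefix; only `IsTotallyComplex K` and `𝔪 ≠ ⊥` are used).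
Typing an input makes the frame assembly unconditional in this binder AS TYPED; BSD / crux L / crux M / E2 are NOT proved by any of this and remain OPEN, proved for NO curve.
References: [Washington1997] §13.1, Prop. 13.2, §13.3; [NeukirchANT1999] Ch. VI §6 Def. (6.4), Cor. (6.6); [deShalit1987] II.1.9.
-/

set_option autoImplicit false
-- the Theorems namespace of this sub repeats the summit name by design (D-0017 nested layout)
set_option linter.dupNamespace false

noncomputable section

open scoped Classical MatrixGroups ModularForm BigOperators NumberField

namespace Summit.BirchSwinnertonDyer.BirchSwinnertonDyer.Theorems.SmallImageRttFrameLayers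

open CongruenceSubgroup WeierstrassCurve Field Polynomial NumberField IsDedekindDomain Matrix
  Literature.NumberTheory.GaloisRepresentations Literature.NumberTheory.LFunctions
  Literature.NumberTheory.GaloisRepresentations.HeckeCharacter Literature.NumberTheory.Automorphic
  Summit.BirchSwinnertonDyer.BirchSwinnertonDyer.Theorems.HeckeThetaPartner Summit.BirchSwinnertonDyer.Rank1Residual
  Literature.NumberTheory.EllipticCurves Literature.NumberTheory.EllipticCurves.ModularForms
  Literature.NumberTheory.EllipticCurves.Rank1Residual
  Literature.NumberTheory.EllipticCurves.Kobayashi2003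
  Literature.NumberTheory.EllipticCurves.GreenbergVatsal2000 ZpExtension
  Literature.NumberTheory.IwasawaTheory Rat.HeightOneSpectrum
  Summit.BirchSwinnertonDyer.Rank1Residual.Supersingular
  Summit.BirchSwinnertonDyer.Rank1Residual.X1.MuLambda
  Summit.BirchSwinnertonDyer.BirchSwinnertonDyer.Theorems.SmallImageLambdaLowerThreeNsThetaTransport
  Summit.BirchSwinnertonDyer.BirchSwinnertonDyer.Theorems

/-! ## §1 A non-zero ideal supported above `p` contains a power of `(p)` -/

section Supp

variable {K : Type} [Field K] [NumberField K] {p : ℕ}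

omit [NumberField K] in
/-- If `𝔣 ≠ 0` and every prime `𝔭_w ⊇ 𝔣` contains `p`, then `(p) ≤ √𝔣` (the primes of the Dedekind domain `𝓞 K` containing `𝔣 ≠ 0` are the `𝔭_w`). [cite: NeukirchANT1999, Ch. I §3 (3.3)] -/
theorem span_natCast_le_radical_of_supp {𝔣 : Ideal (𝓞 K)} (h𝔣 : 𝔣 ≠ ⊥)
    (hsupp : ∀ w : HeightOneSpectrum (𝓞 K), ((p : ℕ) : 𝓞 K) ∉ w.asIdeal → ¬ 𝔣 ≤ w.asIdeal) :
    Ideal.span {((p : ℕ) : 𝓞 K)} ≤ 𝔣.radical := by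
  rw [Ideal.span_singleton_le_iff_mem, Ideal.radical_eq_sInf, Ideal.mem_sInf]
  rintro J ⟨hJ𝔣, hJ⟩
  by_contra hpJ
  have hJne : J ≠ ⊥ := fun h => h𝔣 (le_bot_iff.1 (h ▸ hJ𝔣))
  exact hsupp ⟨J, hJ, hJne⟩ hpJ hJ𝔣

omit [NumberField K] in
/-- **A non-zero ideal supported above `p` contains `(p)^N` for some `N`.** [cite: NeukirchANT1999, Ch. I §3 (3.3)] -/
theorem exists_span_pow_le_of_supp {𝔣 : Ideal (𝓞 K)} (h𝔣 : 𝔣 ≠ ⊥)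
    (hsupp : ∀ w : HeightOneSpectrum (𝓞 K), ((p : ℕ) : 𝓞 K) ∉ w.asIdeal → ¬ 𝔣 ≤ w.asIdeal) :
    ∃ N : ℕ, Ideal.span {((p : ℕ) : 𝓞 K)} ^ N ≤ 𝔣 :=
  Ideal.exists_pow_le_of_le_radical_of_fg (span_natCast_le_radical_of_supp h𝔣 hsupp) (Submodule.fg_span_singleton _)

end Supp

/-! ## §2 The hLay binder for one `ℤ_p`-extension -/

section Layers

variable {K : Type} [Field K] [NumberField K] {p : ℕ} [Fact p.Prime]

/-- ★ **The layers of a `ℤ_p`-extension lie in the ray class fields `K(𝔪·p^{c'+1})`, `c' ≫ 0`**, in the stub's `δ`-form: for `κ' : ZpExtension K p` (`K` totally complex),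
`𝔪 ≠ 0` and `δ > 0` there is `c` with `‖κ'(τ)‖ < δ` for every `c' ≥ c` and every `τ ∈ Gal(K̄/K(𝔪·p^{c'+1}))`. Proof: `‖p‖ⁿ < δ`; the conductor `𝔣ₙ` of the layer `K'_n` is
supported above `p` and `pⁿ ∣ κ'` on `Gal(K̄/K(𝔣ₙ))` (honda g24, `SmallImageRttD2FrameConductor.exists_ideal_forall_pow_dvd_supp`); `(p)^N ≤ 𝔣ₙ` (§1); for `c' + 1 ≥ N`,
`𝔪·p^{c'+1} ≤ 𝔣ₙ` so `Gal(K̄/K(𝔪·p^{c'+1})) ≤ Gal(K̄/K(𝔣ₙ))`. [cite: Washington1997, §13.1, Prop. 13.2] [cite: NeukirchANT1999, Ch. VI §6 Def. (6.4), Cor. (6.6)] -/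
theorem exists_forall_norm_toAdd_lt_of_mem_absGaloisFixingSubgroup [IsTotallyComplex K] (κ' : ZpExtension K p) {𝔪 : Ideal (𝓞 K)} (h𝔪 : 𝔪 ≠ ⊥)
    {δ : ℝ} (hδ : 0 < δ) :
    ∃ c : ℕ, ∀ c' : ℕ, c ≤ c' →
      ∀ τ ∈ absGaloisFixingSubgroup (Literature.NumberTheory.NumberFields.rayClassField K (𝔪 * Ideal.span {((p : ℕ) : 𝓞 K)} ^ (c' + 1))),
        ‖((κ' τ).toAdd : ℤ_[p])‖ < δ := by
  have hp1 : ‖(p : ℤ_[p])‖ < 1 := PadicInt.norm_lt_one_iff_dvd _ |>.mpr (dvd_refl _)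
  obtain ⟨n, hn⟩ := exists_pow_lt_of_lt_one hδ hp1
  obtain ⟨𝔣, h𝔣, hsupp, hdvd⟩ := SmallImageRttD2FrameConductor.exists_ideal_forall_pow_dvd_supp κ' n
  obtain ⟨N, hN⟩ := exists_span_pow_le_of_supp (p := p) h𝔣 hsupp
  refine ⟨N, fun c' hc' τ hτ => ?_⟩
  have hpK : ((p : ℕ) : 𝓞 K) ≠ 0 := by exact_mod_cast (Fact.out : p.Prime).ne_zero
  have hne : 𝔪 * Ideal.span {((p : ℕ) : 𝓞 K)} ^ (c' + 1) ≠ ⊥ :=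
    mul_ne_zero h𝔪 (pow_ne_zero _ (by rw [Ne, Ideal.zero_eq_bot, Ideal.span_singleton_eq_bot]; exact hpK))
  have hle : 𝔪 * Ideal.span {((p : ℕ) : 𝓞 K)} ^ (c' + 1) ≤ 𝔣 :=
    Ideal.mul_le_left.trans ((Ideal.pow_le_pow_right (by omega : N ≤ c' + 1)).trans hN)
  have hτ' : τ ∈ absGaloisFixingSubgroup (Literature.NumberTheory.NumberFields.rayClassField K 𝔣) :=
    SmallImageRttD2FrameConductor.absGaloisFixingSubgroup_rayClassField_mono hne hle hτ
  obtain ⟨w, hw⟩ := hdvd τ hτ'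
  rw [hw]
  calc ‖(p : ℤ_[p]) ^ n * w‖ = ‖(p : ℤ_[p])‖ ^ n * ‖w‖ := by rw [norm_mul, norm_pow]
    _ ≤ ‖(p : ℤ_[p])‖ ^ n * 1 := mul_le_mul_of_nonneg_left (PadicInt.norm_le_one w) (pow_nonneg (norm_nonneg _) _)
    _ < δ := by rw [mul_one]; exact hn

end Layers

/-! ## §3 ★★★ The registered stub, by name -/

/-- ★★★ **`stub_frameLayers_ns` (v17 INPUT fact hLay), PROVED**: the registered signature verbatim — the crux prefix is inert; the conclusion is
`exists_forall_norm_toAdd_lt_of_mem_absGaloisFixingSubgroup` for the stub's totally complex `K` and `𝔪 ≠ 0`. Class field theory of `ℤ_p`-extensions only; typing this input makes the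
road-D frame assembly `stub_charRoadFrame_ns_of₂` unconditional in its hLay binder AS TYPED; BSD, crux L, crux M and E2 are NOT proved by this and remain open.
[cite: Washington1997, Prop. 13.2, §13.1] [cite: NeukirchANT1999, Ch. VI §6 (6.1)–(6.2), Def. (6.4), Cor. (6.6)] -/
theorem stub_frameLayers_ns :
    (∀ (W : WeierstrassCurve ℚ) [W.IsElliptic] [W.IsGloballyMinimal] (p : ℕ) [Fact p.Prime],
          ∀ (hp : p ≠ 2), ClassX7 W p → ¬ W.HasCM → W.frobeniusTrace p = 0 → ¬ Surj W p →
          ¬ (∃ (A : WeierstrassCurve ℚ) (_ : A.IsElliptic) (_ : A.IsGloballyMinimal),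
            A.HasCM ∧ GoodSS A p ∧ A.frobeniusTrace p = 0 ∧
              ∃ e : geomTorsion W (p : ℤ) ≃+ geomTorsion A (p : ℤ),
                ∀ (σ : absoluteGaloisGroup ℚ) (P : geomTorsion W (p : ℤ)), e (σ • P) = σ • e P) →
          ¬ (∃ (A : WeierstrassCurve ℚ) (_ : A.IsElliptic) (_ : A.IsGloballyMinimal) (t : ℚ),
            A.HasGoodReductionAtPrime p ∧ A.frobeniusTrace p = 0 ∧
              (∃ e : geomTorsion W (p : ℤ) ≃+ geomTorsion A (p : ℤ),
                ∀ (σ : absoluteGaloisGroup ℚ) (P : geomTorsion W (p : ℤ)), e (σ • P) = σ • e P) ∧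
              A.entireLFunction 1 / (A.realPeriodRat : ℂ) = ((t : ℚ) : ℂ) ∧ t ≠ 0 ∧ padicValRat p t = 0) →
          ∀ (ε : ℤˣ) (K : Type) [Field K] [NumberField K] (σK : K →+* ℂ) (𝔪 : Ideal (𝓞 K))
            (ψ : HeightOneSpectrum (𝓞 K) → ℂ) (e : PadicAlgCl p ≃+* ℂ),
            ∀ (hK2 : Module.finrank ℚ K = 2), IsTotallyComplex K → 𝔪 ≠ ⊥ →
            (∀ I : Ideal (𝓞 K), Ideal.absNorm I ≠ p) → ¬ p ∣ (NumberField.discr K).natAbs * Ideal.absNorm 𝔪 →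
            (∀ (ℓ : ℕ) [Fact ℓ.Prime], ℓ ∣ (NumberField.discr K).natAbs * Ideal.absNorm 𝔪 → ¬ W.HasGoodReductionAtPrime ℓ) →
            IsGrossencharakter 𝔪 (embType σK) (embTypeConj σK) ψ →
            (∀ n : ℕ, Odd n → n.Coprime ((NumberField.discr K).natAbs * Ideal.absNorm 𝔪) →
              idealPow K ψ (Ideal.span {(n : 𝓞 K)}) = (jacobiSym (NumberField.discr K) n : ℂ) * (n : ℂ) ^ (2 - 1)) →
            (∀ (ℓ : ℕ) [Fact ℓ.Prime], ℓ ≠ p → W.HasGoodReductionAtPrime ℓ →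
              ‖e.symm (∑ᶠ (w : HeightOneSpectrum (𝓞 K)) (_ : Ideal.absNorm w.asIdeal = ℓ), ψ w) -
                (W.frobeniusTrace ℓ : PadicAlgCl p)‖ < 1) →
            (∃ v : HeightOneSpectrum (𝓞 K), v.asIdeal = Ideal.span {(p : 𝓞 K)} ∧ Nat.card (𝓞 K ⧸ v.asIdeal) = p ^ 2) →
            ∀ (hnd : ¬ (p : ℤ) ∣ NumberField.discr K),
          ∀ (Φ : Multiplicative (AddAut (geomTorsion W p)) ≃* GL (Fin 2) (ZMod p))
            (k : Subalgebra (ZMod p) (Matrix (Fin 2) (Fin 2) (ZMod p))) (e₀ : geomTorsion W p ≃+ (Fin 2 → ZMod p)),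
            (∀ (g : Multiplicative (AddAut (geomTorsion W p))) (x : geomTorsion W p),
              e₀ (Multiplicative.toAdd g x) = ((Φ g : GL (Fin 2) (ZMod p)) : Matrix (Fin 2) (Fin 2) (ZMod p)) *ᵥ e₀ x) →
            IsField k → Module.finrank (ZMod p) k = 2 →
            (letI : Module (ZMod p) (geomTorsion W p) := AddSubgroup.torsionBy.zmodModule
              ∀ g : Multiplicative (AddAut (geomTorsion W p)),
                Matrix.trace ((Φ g : GL (Fin 2) (ZMod p)) : Matrix (Fin 2) (Fin 2) (ZMod p)) =
                  LinearMap.trace (ZMod p) (geomTorsion W p) ((Multiplicative.toAdd g).toAddMonoidHom.toZModLinearMap p)) →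
            (galoisRepTorsion W p).range.map Φ.toMonoidHom ≤
              Subgroup.normalizer (Serre1972.unitGroup k : Set (GL (Fin 2) (ZMod p))) →
            ((Serre1972.unitGroup k).comap Φ.toMonoidHom).comap (galoisRepTorsion W p) ≤
              (absGaloisRestrict ℚ K).toMonoidHom.range →
            (∀ τ : absoluteGaloisGroup K, Φ (galoisRepTorsion W p (absGaloisRestrict ℚ K τ)) ∈ Serre1972.unitGroup k) →
          ∀ (M : ℕ) [NeZero M] (g : CuspForm (Gamma0 M) 2) (ι : coeffField g →+* PadicAlgCl p) (Ω : ℂ),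
            ¬ p ∣ M → IsNewform0 g → Literature.NumberTheory.Automorphic.IsCMForm (liftToGamma1 M 2 g) →
            cuspCoeff g p = 0 → IsCohomologicalPlusPeriod g ι Ω →
            (∀ ℓ : ℕ, ℓ.Prime → ¬ ℓ ∣ p * M * W.conductorNorm ℤ →
              ‖embCoeff g ι ℓ - (W.frobeniusTrace ℓ : PadicAlgCl p)‖ < 1) →
            (∀ ℓ : ℕ, ℓ.Prime → ¬ ℓ ∣ (NumberField.discr K).natAbs * Ideal.absNorm 𝔪 →
              embCoeff g ι ℓ = e.symm (∑ᶠ (w : HeightOneSpectrum (𝓞 K)) (_ : Ideal.absNorm w.asIdeal = ℓ), ψ w)) →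
            ∀ (κ : ZpExtension ℚ p) (γ : absoluteGaloisGroup ℚ),
              ∀ (hκ : κ.IsCyclotomic), κ.IsTopGenerator γ → IsCyclotomicVariable p γ →
            ∀ (S₀ : Finset (HeightOneSpectrum (𝓞 ℚ))), (∀ v ∈ S₀, ((p : ℕ) : 𝓞 ℚ) ∉ v.asIdeal) →
              (∀ v : HeightOneSpectrum (𝓞 ℚ), ¬ W.HasGoodReductionAt v → v ∈ S₀) →
              (∀ v : HeightOneSpectrum (𝓞 ℚ), natGenerator v ∣ M → v ∈ S₀) →
            ∀ (S : Set (PadicAlgCl p)) (θ : FramedGaloisRep K (padicCoeffIntegers S) 1) (γK : absoluteGaloisGroup K)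
              (j : (W.baseChange K).geomPrimaryTorsion p →+ (GreenbergSelmer.Cofree θ (padicCoeffField S))),
              ∀ (hS : 0 < Module.finrank ℚ_[p] (padicCoeffField S)),
              (∀ w : HeightOneSpectrum (𝓞 K), (p : 𝓞 K) ∉ w.asIdeal → ¬ 𝔪 ≤ w.asIdeal →
                θ.IsUnramifiedAt w ∧ ∃ P : Polynomial (padicCoeffIntegers S),
                  P.map (padicCoeffIntegers S).subtype = X - C (e.symm (ψ w)) ∧ θ.HasFrobCharpolyAt w P) →
              ∀ (hγK : (κ.restrictOfFinrankEqTwo hp K hK2).IsTopGenerator γK),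
              (∀ v : HeightOneSpectrum (𝓞 K), (p : 𝓞 K) ∈ v.asIdeal →
                ∀ (δ : absoluteGaloisGroup (v.adicCompletion K)) (t : (W.baseChange K).geomPrimaryTorsion p),
                  j (resGalOfEmb (closureEmb (K := K) (v.adicCompletion K)) δ • t) =
                    resGalOfEmb (closureEmb (K := K) (v.adicCompletion K)) δ • j t) →
              Submodule.span (padicCoeffIntegers S) (Set.range j) = ⊤ →
            ∀ (Dψ : SmallImageCharSignedSelmer.SignedTransportDualDataSat (κ.restrictOfFinrankEqTwo hp K hK2) γK
                (GreenbergSelmer.Cofree θ (padicCoeffField S)) (padicCoeffIntegers S) (W.baseChange K) j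
                {w : HeightOneSpectrum (𝓞 K) | ∃ v ∈ S₀, ((natGenerator v : ℕ) : 𝓞 K) ∈ w.asIdeal} ε),
              Module.Finite (IwasawaAlgebra p) Dψ.X → Module.IsTorsion (IwasawaAlgebra p) Dψ.X →
            ∀ L : IwasawaAlgebraO (Set.range ι), L ≠ 0 →
              (∀ n : ℕ, (Even n ↔ ε = 1) → IsCongrModOmegaO (Set.range ι) n ((mazurTateElementK g Ω p n).map ι)
                (((((-1) ^ (n / 2 + 1) * (if ε = 1 then cyclotomicOmegaMinus p n else cyclotomicOmegaPlus p n)).map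
                    (Int.castRingHom (PadicAlgCl p)) : (PadicAlgCl p)[X]) : PowerSeries (PadicAlgCl p)) *
                  iwasawaOToPowerSeries (Set.range ι) L)) →
              ∀ (vp : HeightOneSpectrum (𝓞 K)) (hv : vp.asIdeal = Ideal.span {((p : ℕ) : 𝓞 K)}),
                                (∀ (κ' : ZpExtension K p) (δ : ℝ), 0 < δ → ∃ c : ℕ, ∀ c' : ℕ, c ≤ c' →
                  ∀ τ ∈ absGaloisFixingSubgroup (Literature.NumberTheory.NumberFields.rayClassField K (𝔪 * Ideal.span {((p : ℕ) : 𝓞 K)} ^ (c' + 1))),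
                    ‖((κ' τ).toAdd : ℤ_[p])‖ < δ)) := by
  intro W _ _ p _ hp _ _ _ _ _ _ ε K _ _ σK 𝔪 ψ e hK2 htc h𝔪 _ _ _ _ _ _ _ _ Φ k e₀ _ _ _ _ _ _ _ M _ g ι Ω _ _ _ _ _ _ _ κ γ _ _ _ S₀ _ _ _ S θ γK j hS _ _ _ _ Dψ _ _ L _ _ vp _ κ' δ hδ
  haveI : NumberField.IsTotallyComplex K := htc
  exact exists_forall_norm_toAdd_lt_of_mem_absGaloisFixingSubgroup κ' h𝔪 hδ

end Summit.BirchSwinnertonDyer.BirchSwinnertonDyer.Theorems.SmallImageRttFrameLayers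

end
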